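import Summits.BirchSwinnertonDyer.BirchSwinnertonDyer.Theorems.EdixhovenFibreFiveSevenLTwistTransferAssembly
import Summits.BirchSwinnertonDyer.BirchSwinnertonDyer.Theorems.AdditiveKolyvaginRoadManinFrameResidueProperRAuxPrime
import Summits.BirchSwinnertonDyer.BirchSwinnertonDyer.Theorems.EdixhovenFibreFiveSevenStarredOptimalManinUnitFiveSevenAssembly
import Literature.NumberTheory.PAdicHodge.DualExpOfDeRham
import HarnessLib

/-!
# Route `AdditiveKolyvaginRoad`, the ORIGINAL crux #7 `ManinFrameResidueProper` (stmt-BirchSwinnertonDyer-20483) —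
# WITHOUT the T10 antecedents (Edixhoven 1991 Thm 3 ×2, Dokchitser–Dokchitser 2015 5.1(1)) — from F″, and from the four cites

Cell `pub/bsd-wall`, seat `bsd-wall-manin-p1` g9 (explicit-unit; payload item stmt-BirchSwinnertonDyer-20483; `--supports`
20483, helper). THEOREMS ONLY; CONDITIONAL RESULTS; nothing is closed; BSD is not proved by this file.

The T10 repair of crux #7 (tenure desk bsd-wall-add g6, 2026-08-27) prefixed the proper-residue statement with three
printed antecedents — `EdixhovenManinNonPotOrdinary → EdixhovenManinKodairaType → DokchitserIsogenyMinimalDiscriminant →`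
— giving `ManinFrameResidueProperR` (stmt-20709), the binder `hR` of the route's `closes`. The Kato road that now
conditionally closes 20709 (`LTwistTransfer.maninFrameResidueProperR_of_kato_of_transferWitness`, edix-p3 g3, p594464;
`…ROfKato`, `…ROfSL2NeronValues`) never touches those antecedents (they are introduced as `_e1 _e2 dd` and unused), nor
the residue clause `hres`, nor the degree clause `hall`. This file records that fact in the kernel: the SAME proof gives
the ORIGINAL statement `ManinFrameResidueProper` (20483) —
* `maninFrameResidueProper_of_kato_of_transferWitness : F″ → hW → ManinFrameResidueProper` (proof text = edix-p3's,
  minus the three unused intros),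
* `maninFrameResidueProper_of_kato : F″ → ManinFrameResidueProper` (hW := `AuxPrime.transferWitness`, manin-p1 g7),
* `maninFrameResidueProper_of_cites : hT₂ → hasDualExp_of_isDeRham → hDR → P1 → ManinFrameResidueProper`,
* `maninFrameResidueProperR_of_proper : ManinFrameResidueProper → ManinFrameResidueProperR` (pure logic),
so 20483 and 20709 are conditionally closed on the SAME four cite facts and the Edixhoven/Dokchitser antecedents of 20709
carry no weight on the Kato road (planner datum: `closes` could bind `hR` from 20483 by `maninFrameResidueProperR_of_proper`).
[F″ = `kato_neron_isIntegral_twistedSymbolSum_of_additive_five_le`; cites as in `…ROfSL2NeronValues`.]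
-/

set_option autoImplicit false
-- the Theorems directory repeats the summit name (D-0017)
set_option linter.dupNamespace false

noncomputable section

open scoped Classical MatrixGroups

open WeierstrassCurve NumberField Literature.NumberTheory.EllipticCurves
  Literature.NumberTheory.EllipticCurves.ModularForms
  Literature.NumberTheory.EllipticCurves.Rank1Residual
  Literature.NumberTheory.PAdicHodge
  Literature.NumberTheory.DiophantineGeometry IsDedekindDomain Rat.HeightOneSpectrum
  Summit.BirchSwinnertonDyer.Rank1Residual Summit.BirchSwinnertonDyer.Rank1Residual.Additive
  Summit.BirchSwinnertonDyer.BirchSwinnertonDyer.Theorems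
  Summit.BirchSwinnertonDyer.BirchSwinnertonDyer.Theses.AdditiveKolyvaginRoad CongruenceSubgroup

namespace Summit.BirchSwinnertonDyer.BirchSwinnertonDyer.Theorems.ManinFrameResidueProperOfKato

/-- **The original crux #7 `ManinFrameResidueProper` (20483) from F″ and the transfer witness — no Edixhoven, no
Dokchitser, no Ihara.** Proof text = `LTwistTransfer.maninFrameResidueProperR_of_kato_of_transferWitness` (edix-p3 g3)
without its three unused antecedent intros: a member with a Manin-unit conductor-level datum (`p ∈ {5,7}`:
`stub_memberManinUnit_fiveSeven_of_kato57` off local `p`-torsion, the Kosters–Pannekoek branch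
`exists_datum_not_dvd_c_of_kato_of_transferWitness_of_torsion` on it; `p ≥ 11`: `exists_member_not_dvd_c_of_tameTwistL`),
prime-to-`p` transport to `W` (`ManinFrameTransport`), Hoffstein–Luo odd Heegner frame (`ManinFrameFromDatum`).
CONDITIONAL RESULT; nothing is closed. [cite: Kato2004Asterisque, (8.1.3) (p. 180), Thm. 9.7 (p. 189)]
[cite: KimNakamura2020, Cor. 2.4] [cite: KostersPannekoek2017, Thm. 1] -/
theorem maninFrameResidueProper_of_kato_of_transferWitness
    (hK : kato_neron_isIntegral_twistedSymbolSum_of_additive_five_le)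
    (hW : ∀ (p : ℕ) [Fact p.Prime] (V₀ : WeierstrassCurve ℚ) [V₀.IsElliptic] [V₀.IsGloballyMinimal],
      (p = 5 ∨ p = 7) → Addv V₀ p → Irr V₀ p →
      ∃ q : ℕ, q.Prime ∧ q ≠ 2 ∧ q ≠ p ∧ ¬ q ∣ V₀.conductorNorm ℤ ∧
        ¬ IsSquare ((((-1 : ℤ) ^ (q / 2) * q : ℤ)) : ZMod p) ∧
        ¬ (p : ℤ) ∣ ((q : ℤ) - 1) * (((q : ℤ) + 1) ^ 2 - V₀.LFunction q ^ 2)) :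
    ManinFrameResidueProper := by
  intro hPub W _ _ p hp _ hp5 hadd hirr hres hall hr
  have hnf : exists_isNewformOf := hPub.2.2.2.2.2.1
  -- a member with a Manin-unit datum, by prime range and locus
  have hmem : ∃ (W₀ : WeierstrassCurve ℚ) (_ : W₀.IsElliptic) (_ : W₀.IsGloballyMinimal)
      (D₀ : ModularParametrizationData W₀ (W.conductorNorm ℤ)),
      IsIsogenous W W₀ ∧ ¬ (p : ℤ) ∣ D₀.c := by
    rcases lt_or_ge p 11 with h11 | h11
    · by_cases hPT : ∀ (W' : WeierstrassCurve ℚ) (_ : W'.IsElliptic) (_ : W'.IsGloballyMinimal),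
          IsIsogenous W W' → ∀ P : (W'.baseChange ℚ_[p]).toAffine.Point, p • P = 0 → P = 0
      · exact ManinFrameResidueProperRTameTwist.stub_memberManinUnit_fiveSeven_of_kato57 hK hnf W hp5 h11 hadd
          hirr hres hall (fun W' hE' hM' hiso P hP ↦ hPT W' hE' hM' hiso P hP)
      · push Not at hPT
        obtain ⟨W', hE', hM', hiso, P, hP, hP0⟩ := hPT
        have hp57 : p = 5 ∨ p = 7 := by
          have hpr := hp.out
          interval_cases p
          · exact Or.inl rfl
          · exact absurd hpr (by norm_num)
          · exact Or.inr rfl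
          · exact absurd hpr (by norm_num)
          · exact absurd hpr (by norm_num)
          · exact absurd hpr (by norm_num)
        obtain ⟨D, hc⟩ := LTwistTransfer.exists_datum_not_dvd_c_of_kato_of_transferWitness_of_torsion hnf hK hW W
          hp57 hadd hirr ⟨W', hE', hM', P, hiso, hP0, hP⟩
        exact ⟨W, ‹_›, ‹_›, D, isIsogenous_self W, hc⟩
    · -- F″ ⟹ F′ (the `7 < p` clause of F″ is void)
      exact ManinFrameResidueProperRTameTwist.exists_member_not_dvd_c_of_tameTwistL
        (fun V _ _ N _ f hf p _ h7 hg hm hi m _ hc χ hχp hχ1 hord ϖ r ↦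
          hK V f hf p (by omega) hg hm hi m hc (Or.inl h7) χ hχp hχ1 hord ϖ r) hnf W h11 hadd hirr
  obtain ⟨W₀, hE₀, hM₀, D₀, hiso, hc₀⟩ := hmem
  haveI := hE₀
  haveI := hM₀
  -- transport to a datum of `W` with `p ∤ c` (prime-to-`p` isogeny multiplier under Irr)
  obtain ⟨Dt, hc⟩ := ManinFrameTransport.exists_modularParametrizationData_not_dvd_of_partner W hp.out hirr hiso D₀ hc₀
  -- the Hoffstein–Luo odd Heegner frame
  have hp2 : p ≠ 2 := by omega
  exact ManinFrameFromDatum.exists_oddHeegnerFrame_of_exists_not_dvd hnf hPub.2.2.2.2.2.2.1 W p hr hp2 ⟨Dt, hc⟩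

/-- **20483 ⟸ F″ alone** (hW := the PROVED transfer witness `AuxPrime.transferWitness`, Chebotarev + `GL₂(𝔽_p)` group
theory, manin-p1 g7). CONDITIONAL on the cite-only F″; nothing is closed.
[cite: Kato2004Asterisque, (8.1.3) (p. 180), Thm. 9.7 (p. 189)] [cite: KimNakamura2020, Cor. 2.4] -/
theorem maninFrameResidueProper_of_kato (hK : kato_neron_isIntegral_twistedSymbolSum_of_additive_five_le) :
    ManinFrameResidueProper :=
  maninFrameResidueProper_of_kato_of_transferWitness hK AuxPrime.transferWitness

/-- **20483 ⟸ the four cite facts** {P1 = Kato 2004 (8.1.3)/9.7/6.6(1)/13.6 at the member in the Néron coordinate,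
(S5b-tower), Kato II Prop. 1.2.3 (surjectivity half), de Rham of `V_pE`} — the same cone as 20709's closer
`ManinFrameResidueProperROfSL2NeronValues.maninFrameResidueProperR_of_sl2NeronValues_of_hasDualExp`.
CONDITIONAL RESULT (conditional-result); the item stays open; BSD is not proved by this.
[cite: Kato2004Asterisque, (8.1.3) (p. 180), Thm. 9.7 (p. 189), Thm. 6.6 (1) (p. 163), Thm. 13.6 (p. 227)]
[cite: Kato1993LNM1553, Ch. II Prop. 1.2.3 and Thm. 1.4.1 (3)-(4)] [cite: BlochKato1990, Prop. 3.8, Example 3.11] -/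
theorem maninFrameResidueProper_of_cites
    (hT₂ : exists_smul_range_expStarCoord_tower_iff_trace_log) (hP' : hasDualExp_of_isDeRham)
    (hDR : isDeRham_restrictedRationalTateRep) (hP1 : Kato2004.exists_member_sl2ZetaElement_neron_values) :
    ManinFrameResidueProper :=
  maninFrameResidueProper_of_kato
    (KatoAssemblySocket.kato_neron_five_le_of_sl2NeronValues hT₂
      (cupLogInjective_and_hasDualExp_of_isDeRham_of_hasDualExp hP') hDR hP1)

/-- **20483 ⟹ 20709** (pure logic: `ManinFrameResidueProperR` is `ManinFrameResidueProper`'s body prefixed by three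
antecedents). With `maninFrameResidueProper_of_cites` this shows the Edixhoven/Dokchitser antecedents of the T10
repair carry no weight on the Kato road. [cite: EdixhovenManin1991, Thm. 3] -/
theorem maninFrameResidueProperR_of_proper (h : ManinFrameResidueProper) : ManinFrameResidueProperR :=
  fun _ _ _ ↦ h

end Summit.BirchSwinnertonDyer.BirchSwinnertonDyer.Theorems.ManinFrameResidueProperOfKato

end
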